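import Literature.NumberTheory.Automorphic.AdelicUnitaryGroupDatum        -- ★ `cmDatum` (the CM unitary datum; `Local v = ↥(«local» …)`)
import Literature.NumberTheory.Automorphic.UnitaryGroupLocalCongr          -- ★ `adelicForm_map_adeleToLocal`
import Literature.NumberTheory.Automorphic.UnitaryGroupLocalFactors         -- ★ `continuous_conjLocal`
import Mathlib.Topology.Instances.Matrix
import Mathlib.Topology.Algebra.Constructions
import HarnessLib

/-!
# Continuity INTO a unitary group is continuity of matrices
# (`U(σ, J)(R) ≤ GL_n(R)` carries the units topology; on it the inverse is the polynomial map `g ↦ J′·(σ g)ᵀ·J`)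

Topic `NumberTheory/Automorphic`; namespace `Literature.NumberTheory.Automorphic.UnitaryGroup`.  THEOREMS ONLY (no definition, no instance, no notation,
no named fact, no `sorry`).  Cell `pub/hodgecm-mathlib` (D-0151), crux H413 = `stmt-HodgeConjecture-24833`; road «W′» = «R1LL-WILD», (Ψ3) chain of B-p04 (g35)
(architect A-p16 (g28) A-37∕A-44; (W′-B6) F0P3-p01 (g14) sub-socket map 12:05Z: «B-p04 proves `ContinuousAt (N i) s`» for the window families `N ND : ℕ → Z(t₀) → H_v`
of p08 (g15) ∕ B-p08 (g28)).  FILE 2c-generic: the tool that reduces `ContinuousAt (N i) s` to continuity of the matrix ENTRIES of the normal form.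

THE POINT.  `GL_n(R)` carries Mathlib's units topology (induced by `g ↦ (g, g⁻¹)`), so a map `X → GL_n(R)` is continuous iff BOTH `x ↦ g(x)` and `x ↦ g(x)⁻¹` are
continuous as matrices (`Units.continuous_iff`); over a ring whose inversion is not continuous the second condition is not automatic.  On a unitary group
`U(σ, J) = {g | (σg)ᵀ J g = J}` with `J` left-invertible (`J′ J = 1`) the inverse is the POLYNOMIAL map `g⁻¹ = J′ (σ g)ᵀ J` (§1), so for `σ` continuous a map
`X → U(σ, J)` is continuous (at a point ∕ everywhere) as soon as its MATRIX is (§2).  §3 instantiates at the CM carriers `(cmDatum L N H).Local v = U(H)(L⁺_v)`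
(`σ = c ⊗ 1` continuous ★ `continuous_conjLocal`, `J = H ⊗ 1` with `H′ H = 1`) and at the rank-one letter's `H_v = U(Φ₂)_v × U(Φ₁)_v` (`Φ_N² = 1`, §3).

* §1 `coe_inv_eq_leftInv_mul_of_mem_unitaryGroupOfForm` — `↑g⁻¹ = J′ * (↑g).map σ)ᵀ * J` for `g ∈ U(σ, J)`, `J′ * J = 1`.
* §2 `continuousAt_of_coe`, `continuous_of_coe` (maps into `↥(unitaryGroupOfForm σ J)`), `continuousAt_iff_coe`.
* §3 `antidiagForm_two_mul_self`, `antidiagForm_one_mul_self`; `cmDatumLocal_continuousAt_of_coe`, `cmDatumLocal_continuous_of_coe` (any `H` with a left inverse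
  `H′`), and the pair forms `continuousAt_prodMk_cmDatumLocal_of_coe` for `H_v`.

HONEST LABEL: HC_CM is proved only modulo the 2 remaining named inputs (hLiu418, h413) until rung 0 closes; this file is unconditional topology of matrix groups.

## References
* [Mok2014] C. P. Mok, *Endoscopic classification of representations of quasi-split unitary groups*, Mem. AMS 235 (2015): §1 Notation p. 5 (`U(N) = {g | ᵗc(g) J g = J}`).
* [Bourbaki1995] N. Bourbaki, *General Topology: Chapters 1–4* (1995): Ch. III §1 (topological groups; units topology).
* [PlatonovRapinchuk1994] V. Platonov, A. Rapinchuk, *Algebraic Groups and Number Theory* (1994): §3.1 (topology on `G(K_v)` from matrix entries).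
-/

set_option autoImplicit false

noncomputable section

open Set Filter Topology Matrix NumberField IsDedekindDomain

namespace Literature.NumberTheory.Automorphic.UnitaryGroup

open Literature.NumberTheory.Automorphic

/-! ## §1 The inverse on `U(σ, J)` is a polynomial map -/

section Inverse

variable {n : Type*} [Fintype n] [DecidableEq n] {R : Type*} [CommRing R]

/-- **`g⁻¹ = J′ (σ g)ᵀ J` on `U(σ, J)`** when `J′ J = 1`: from `(σg)ᵀ J g = J` multiply by `g⁻¹` on the right and by `J′` on the left (left-inverse variant of
★ `GelbartRogawski1991…coe_inv_eq_of_mem_unitaryGroupOfForm`, which assumes `IsUnit H.det`; stated here to keep this file's imports light). [cite: Mok2014, §1 Notation p. 5] -/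
theorem coe_inv_eq_leftInv_mul_of_mem_unitaryGroupOfForm {σ : R →+* R} {J J' : Matrix n n R} (hJ : J' * J = 1) {g : GL n R}
    (hg : g ∈ unitaryGroupOfForm σ J) :
    ((g⁻¹ : GL n R) : Matrix n n R) = J' * ((g : Matrix n n R).map σ)ᵀ * J := by
  rw [mem_unitaryGroupOfForm_iff] at hg
  have h1 : ((g : Matrix n n R).map σ)ᵀ * J = J * ((g⁻¹ : GL n R) : Matrix n n R) := by
    calc ((g : Matrix n n R).map σ)ᵀ * J = ((g : Matrix n n R).map σ)ᵀ * J * ((g : Matrix n n R) * ((g⁻¹ : GL n R) : Matrix n n R)) := by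
          rw [← Units.val_mul, mul_inv_cancel, Units.val_one, Matrix.mul_one]
      _ = (((g : Matrix n n R).map σ)ᵀ * J * (g : Matrix n n R)) * ((g⁻¹ : GL n R) : Matrix n n R) := by simp only [Matrix.mul_assoc]
      _ = J * ((g⁻¹ : GL n R) : Matrix n n R) := by rw [hg]
  calc ((g⁻¹ : GL n R) : Matrix n n R) = (J' * J) * ((g⁻¹ : GL n R) : Matrix n n R) := by rw [hJ, Matrix.one_mul]
    _ = J' * (((g : Matrix n n R).map σ)ᵀ * J) := by rw [Matrix.mul_assoc, h1]
    _ = J' * ((g : Matrix n n R).map σ)ᵀ * J := by rw [Matrix.mul_assoc]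

end Inverse

/-! ## §2 Continuity into `U(σ, J)` from continuity of the matrix -/

section Continuity

variable {n : Type*} [Fintype n] [DecidableEq n] {R : Type*} [CommRing R] [TopologicalSpace R] [IsTopologicalRing R]
variable {X : Type*} [TopologicalSpace X]

omit [DecidableEq n] in
/-- The polynomial map `M ↦ J′ (σ M)ᵀ J` is continuous for `σ` continuous. [cite: Bourbaki1995, Ch. III §1] -/
theorem continuous_conjTransposeForm {σ : R →+* R} (hσ : Continuous σ) (J J' : Matrix n n R) :
    Continuous fun M : Matrix n n R => J' * (M.map σ)ᵀ * J :=
  (continuous_const.matrix_mul ((continuous_id.matrix_map hσ).matrix_transpose)).matrix_mul continuous_const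

/-- **CONTINUITY INTO `U(σ, J)` AT A POINT IS CONTINUITY OF THE MATRIX**: `σ` continuous, `J′ J = 1`; if `x ↦ ↑(g x)` is continuous at `x₀` as a matrix-valued map
then `g : X → U(σ, J)` is continuous at `x₀` (units topology: the inverse `J′ (σ g)ᵀ J` is continuous too). [cite: Bourbaki1995, Ch. III §1] [cite: PlatonovRapinchuk1994, §3.1] -/
theorem continuousAt_of_coe {σ : R →+* R} (hσ : Continuous σ) {J J' : Matrix n n R} (hJ : J' * J = 1)
    {g : X → ↥(unitaryGroupOfForm σ J)} {x₀ : X} (h : ContinuousAt (fun x => ((g x : GL n R) : Matrix n n R)) x₀) :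
    ContinuousAt g x₀ := by
  have hind : IsInducing (fun u : ↥(unitaryGroupOfForm σ J) => Units.embedProduct (Matrix n n R) (u : GL n R)) :=
    Units.isInducing_embedProduct.comp IsInducing.subtypeVal
  rw [hind.continuousAt_iff]
  have hinv : ContinuousAt (fun x => (((g x : GL n R)⁻¹ : GL n R) : Matrix n n R)) x₀ := by
    have heq : (fun x => (((g x : GL n R)⁻¹ : GL n R) : Matrix n n R)) =
        (fun M : Matrix n n R => J' * (M.map σ)ᵀ * J) ∘ fun x => ((g x : GL n R) : Matrix n n R) :=
      funext fun x => coe_inv_eq_leftInv_mul_of_mem_unitaryGroupOfForm hJ (g x).2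
    rw [heq]
    exact (continuous_conjTransposeForm hσ J J').continuousAt.comp h
  have hpair : ContinuousAt (fun x => (((g x : GL n R) : Matrix n n R), MulOpposite.op (((g x : GL n R)⁻¹ : GL n R) : Matrix n n R))) x₀ :=
    h.prodMk (MulOpposite.continuous_op.continuousAt.comp hinv)
  exact hpair

/-- **CONTINUITY INTO `U(σ, J)` IS CONTINUITY OF THE MATRIX** (global form). [cite: Bourbaki1995, Ch. III §1] [cite: PlatonovRapinchuk1994, §3.1] -/
theorem continuous_of_coe {σ : R →+* R} (hσ : Continuous σ) {J J' : Matrix n n R} (hJ : J' * J = 1)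
    {g : X → ↥(unitaryGroupOfForm σ J)} (h : Continuous fun x => ((g x : GL n R) : Matrix n n R)) : Continuous g :=
  continuous_iff_continuousAt.2 fun _ => continuousAt_of_coe hσ hJ h.continuousAt

/-- The criterion is an equivalence (the coercion to matrices is continuous). [cite: Bourbaki1995, Ch. III §1] -/
theorem continuousAt_iff_coe {σ : R →+* R} (hσ : Continuous σ) {J J' : Matrix n n R} (hJ : J' * J = 1)
    {g : X → ↥(unitaryGroupOfForm σ J)} {x₀ : X} :
    ContinuousAt g x₀ ↔ ContinuousAt (fun x => ((g x : GL n R) : Matrix n n R)) x₀ :=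
  ⟨fun h => (Units.continuous_val.comp continuous_subtype_val).continuousAt.comp h, continuousAt_of_coe hσ hJ⟩

end Continuity

/-! ## §3 The CM carriers `(cmDatum L N H).Local v` and the pair `H_v` -/

section CM

variable (L : Type) [Field L] [NumberField L] [IsCMField L] (v : HeightOneSpectrum (𝓞 ↥(maximalRealSubfield L)))
variable {X : Type*} [TopologicalSpace X]

omit [NumberField L] [IsCMField L] in
/-- `Φ₂² = 1` for the rank-two antidiagonal form of the letter. [cite: Mok2014, §1 Notation p. 5 (the antidiagonal `J`)] -/
theorem antidiagForm_two_mul_self :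
    (Matrix.of fun i j : Fin 2 => if i.val + j.val + 1 = 2 then (1 : L) else 0) * (Matrix.of fun i j : Fin 2 => if i.val + j.val + 1 = 2 then (1 : L) else 0) = 1 := by
  ext i j
  fin_cases i <;> fin_cases j <;> simp [Matrix.mul_apply, Fin.sum_univ_two]

omit [NumberField L] [IsCMField L] in
/-- `Φ₁² = 1` for the rank-one form. [cite: Mok2014, §1 Notation p. 5 (the antidiagonal `J`)] -/
theorem antidiagForm_one_mul_self :
    (Matrix.of fun i j : Fin 1 => if i.val + j.val + 1 = 1 then (1 : L) else 0) * (Matrix.of fun i j : Fin 1 => if i.val + j.val + 1 = 1 then (1 : L) else 0) = 1 := by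
  ext i j
  fin_cases i; fin_cases j; simp [Matrix.mul_apply]

omit [IsCMField L] in
/-- The local form of `cmDatum L N H` has the left inverse `H′ ⊗ 1` when `H′ H = 1`. [cite: PlatonovRapinchuk1994, §3.1] -/
theorem localForm_leftInverse {N : ℕ} {H H' : Matrix (Fin N) (Fin N) L} (hH : H' * H = 1) :
    H'.map (algebraMap L (LocalRing L v)) * (adelicForm L N H).map (adeleToLocal L v) = 1 := by
  rw [adelicForm_map_adeleToLocal, ← Matrix.map_mul, hH, Matrix.map_one _ (map_zero _) (map_one _)]

/-- **CONTINUITY INTO `U(H)(L⁺_v) = (cmDatum L N H).Local v` AT A POINT IS CONTINUITY OF THE MATRIX** (`H` with a left inverse `H′`; `σ = c ⊗ 1` is continuous).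
[cite: PlatonovRapinchuk1994, §3.1] [cite: Mok2014, §1 Notation p. 5] -/
theorem cmDatumLocal_continuousAt_of_coe {N : ℕ} {H H' : Matrix (Fin N) (Fin N) L} (hH : H' * H = 1)
    {g : X → (cmDatum L N H).Local v} {x₀ : X}
    (h : ContinuousAt (fun x => ((g x).val.val : Matrix (Fin N) (Fin N) (LocalRing L v))) x₀) : ContinuousAt g x₀ :=
  continuousAt_of_coe (continuous_conjLocal L (IsCMField.complexConj L) v) (localForm_leftInverse L v hH) h

/-- Global form. [cite: PlatonovRapinchuk1994, §3.1] -/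
theorem cmDatumLocal_continuous_of_coe {N : ℕ} {H H' : Matrix (Fin N) (Fin N) L} (hH : H' * H = 1)
    {g : X → (cmDatum L N H).Local v} (h : Continuous fun x => ((g x).val.val : Matrix (Fin N) (Fin N) (LocalRing L v))) : Continuous g :=
  continuous_of_coe (continuous_conjLocal L (IsCMField.complexConj L) v) (localForm_leftInverse L v hH) h

/-- The equivalence at the CM carrier. [cite: PlatonovRapinchuk1994, §3.1] -/
theorem cmDatumLocal_continuousAt_iff_coe {N : ℕ} {H H' : Matrix (Fin N) (Fin N) L} (hH : H' * H = 1)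
    {g : X → (cmDatum L N H).Local v} {x₀ : X} :
    ContinuousAt g x₀ ↔ ContinuousAt (fun x => ((g x).val.val : Matrix (Fin N) (Fin N) (LocalRing L v))) x₀ :=
  continuousAt_iff_coe (continuous_conjLocal L (IsCMField.complexConj L) v) (localForm_leftInverse L v hH)

/-- **`H_v = U(Φ₂)_v × U(Φ₁)_v`: a map into the rank-one letter's local carrier is continuous at `x₀` as soon as both MATRICES are.**
[cite: PlatonovRapinchuk1994, §3.1] [cite: Mok2014, §1 Notation p. 5] -/
theorem continuousAt_prodMk_cmDatumLocal_of_coe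
    {g₂ : X → (cmDatum L 2 (Matrix.of fun i j : Fin 2 => if i.val + j.val + 1 = 2 then (1 : L) else 0)).Local v}
    {g₁ : X → (cmDatum L 1 (Matrix.of fun i j : Fin 1 => if i.val + j.val + 1 = 1 then (1 : L) else 0)).Local v} {x₀ : X}
    (h₂ : ContinuousAt (fun x => ((g₂ x).val.val : Matrix (Fin 2) (Fin 2) (LocalRing L v))) x₀)
    (h₁ : ContinuousAt (fun x => ((g₁ x).val.val : Matrix (Fin 1) (Fin 1) (LocalRing L v))) x₀) :
    ContinuousAt (fun x => (g₂ x, g₁ x)) x₀ :=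
  (cmDatumLocal_continuousAt_of_coe L v (antidiagForm_two_mul_self L) h₂).prodMk
    (cmDatumLocal_continuousAt_of_coe L v (antidiagForm_one_mul_self L) h₁)

/-- Global pair form. [cite: PlatonovRapinchuk1994, §3.1] -/
theorem continuous_prodMk_cmDatumLocal_of_coe
    {g₂ : X → (cmDatum L 2 (Matrix.of fun i j : Fin 2 => if i.val + j.val + 1 = 2 then (1 : L) else 0)).Local v}
    {g₁ : X → (cmDatum L 1 (Matrix.of fun i j : Fin 1 => if i.val + j.val + 1 = 1 then (1 : L) else 0)).Local v}
    (h₂ : Continuous fun x => ((g₂ x).val.val : Matrix (Fin 2) (Fin 2) (LocalRing L v)))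
    (h₁ : Continuous fun x => ((g₁ x).val.val : Matrix (Fin 1) (Fin 1) (LocalRing L v))) :
    Continuous fun x => (g₂ x, g₁ x) :=
  (cmDatumLocal_continuous_of_coe L v (antidiagForm_two_mul_self L) h₂).prodMk
    (cmDatumLocal_continuous_of_coe L v (antidiagForm_one_mul_self L) h₁)

/-- A pair with a CONSTANT (or separately continuous) second component and first component given by matrices: the shape of the window families
`N i t = (n i t, (t : H_v).2)`. [cite: PlatonovRapinchuk1994, §3.1] -/
theorem continuousAt_prodMk_cmDatumLocal_of_coe_fst
    {g₂ : X → (cmDatum L 2 (Matrix.of fun i j : Fin 2 => if i.val + j.val + 1 = 2 then (1 : L) else 0)).Local v}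
    {g₁ : X → (cmDatum L 1 (Matrix.of fun i j : Fin 1 => if i.val + j.val + 1 = 1 then (1 : L) else 0)).Local v} {x₀ : X}
    (h₂ : ContinuousAt (fun x => ((g₂ x).val.val : Matrix (Fin 2) (Fin 2) (LocalRing L v))) x₀) (h₁ : ContinuousAt g₁ x₀) :
    ContinuousAt (fun x => (g₂ x, g₁ x)) x₀ :=
  (cmDatumLocal_continuousAt_of_coe L v (antidiagForm_two_mul_self L) h₂).prodMk h₁

end CM

end Literature.NumberTheory.Automorphic.UnitaryGroup

end
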